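import Summits.QuantumFields.YangMills.Theorems.UnitScaleTiltProp7CoerciveSlotsOfNormG0
import Summits.QuantumFields.YangMills.Theorems.UnitScaleTiltProp7SectET3CombLettersT3
import Summits.QuantumFields.YangMills.Theorems.UnitScaleTiltProp7QprimeCombL2Defs
import HarnessLib

/-!
# Route `UnitScaleTilt`, crux K1 «MinimiserStabilityRegPr» (stmt-QuantumFields-19200) — ARCHITECTURE (A′)-on-Σ, COMB SLOTS OF RECORD `(Rr, Qc) := (RcombL2, Qkc)` (★p1 g17 WORDS 21 (c), 23 (d), 25 (b)):
# **THE (COERC) AND (LANDAU-S) CONJUNCTS OF THE Σ-JUNCTION DOOR ✓`Prop7HcoSOfSigmaRows.hcoS_of_sigmaRowsS` AT THE SLOTS OF RECORD** — (COERC) from the ONE displayed N06 row `norm_G₀ᶜ`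
# (w4 g8's generic ✓`coercive_slots_DeltaEta_of_normG₀` at `Rr := RcombL2 W = projR (covLapSite W) (QprimeCombL2 W)`, px6 g5's `laplaceAcR` letter), (LANDAU-S) from `IsLandauPrint` (✓`RcombL2_DstarL2_eq_zero_of_isLandauPrint_of_regPr`)

Cell `ym3-torus` ∕ width seat `ym-ust-19200-w1` (gen 14; «whoever lands second of {px6 letters, w1 Defs} types the comb one-liner», WORD 23 (d) — w4 g8 yielded the filing, courtesy bytes
`ym-ust-19200-w4/g8/…CoerciveOfNormG0Comb.draft.w4g8.lean` adapted to the slot of record).  THEOREMS ONLY (0 `def`, 0 `sorry`); `--supports stmt-QuantumFields-19200 --as helper`, count-neutral.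
YM₃ on T³ is a ladder rung (R3), not d = 4, not infinite volume, not the Clay problem; nothing here claims the stub, the crux, `hcoS`, [B9] Thm 3.11 ∕ 3.3 or the gap — `norm_G₀ᶜ` stays DISPLAYED.

WHAT IS PROVED (ns `…Theorems.Prop7CoerciveOfNormG0Comb`; member `F`, `n ≤ K`, weights `c₀ cB > 0`, `a ≥ 0`, background `W ∈ 𝔘_k(ε₀)`):
* ★★★`coercive_laplaceAcR_RcombL2_of_normG₀` — a right inverse `G₀` of `Δ_aᶜ(W) := laplaceAcR … (DeltaEtaSlot) W (RcombL2 W)` with `‖G₀ f‖ ≤ B₀‖f‖` and `1029·ε₀·B₀ < 1` gives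
  `B₀⁻¹‖y‖² ≤ re⟪y, Δ_aᶜ(W) y⟫` for all `y` (the door's (COERC) conjunct with `γ := B₀⁻¹`); `…_laplaceAK` (the same in the door's literal `laplaceAK` letter); ★`pos_laplaceAcR_RcombL2_of_normG₀`;
* ★★★`coerc_landau_RcombL2_of_normG₀_of_isLandauPrint` — (COERC) ∧ (LANDAU-S) at the slots of record from {`norm_G₀ᶜ` datum, `RegPr F n K ε₀ W` with the L-only windows of
  ✓`bgT_pull_mem_unitaryUnits_of_regPr`, `IsLandauPrint F n K W X`} — the two conjuncts the E2E feeds to ✓`hcoS_of_sigmaRowsS` at `(Rr, Qc) := (fun F n K W => RcombL2 F n K (c₀ F.L) W, Qkc)`.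
HONEST SCOPE.  Composition by `rfl`∕`exact` over landed theorems (w4 g8 ✓p691966, px6 g5 ✓p692354∕p692776, w1 ✓p691620∕p692807); constants crude (`1029`); the flat-member certificate of
`norm_G₀ᶜ` is px6's located open lemma «COMB-FLAT COERCIVITY» (★p1 WORD 25 (c)), not touched here.

References: T. Bałaban, CMP **99** (1985) 389–434 [Balaban1985BackgroundPropagators] ((3.10) p.392, (3.19) p.393, (3.21)–(3.27) pp.394–395, Thm 3.3 p.399, Thm 3.11 p.416); CMP **102** (1985)
277–309 [Balaban1985Variational] ((21) p.281, (110) p.294, (141)–(142) p.299); CMP **99** (1985) 75–102 [Balaban1985RegularSpaces] ((1.38) p.82).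
-/

set_option autoImplicit false

noncomputable section

open scoped Matrix.Norms.L2Operator InnerProductSpace BigOperators

namespace Summit.QuantumFields.YangMills.Theorems.Prop7CoerciveOfNormG0Comb

open Literature.MathematicalPhysics.QuantumFieldTheory.Balaban1983to89
open Literature.MathematicalPhysics.QuantumFieldTheory.Balaban1983to89.T3ContinuumYM3Torus
open Literature.MathematicalPhysics.QuantumFieldTheory.Balaban1983to89.T3PrintedRegularMinimiser (RegPr)
open B7Prop2Explicit (C0 c2')
open B11Eq103H1Complex (SiteL2K BondL2K laplaceAK)
open Summit.QuantumFields.YangMills.Theorems.Prop7SectET3Transport (periodsT3)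
open Summit.QuantumFields.YangMills.Theorems.Prop7SectET3HilbertLetters (W₂ toL2 DL2 DstarL2 covLapSite)
open Summit.QuantumFields.YangMills.Theorems.Prop7SectET3WilsonHessian (DeltaEtaSlot)
open Summit.QuantumFields.YangMills.Theorems.Prop7SectET3CombLetters (Qkc laplaceAcR laplaceAcR_eq_laplaceAK)
open Summit.QuantumFields.YangMills.Theorems.Prop7CoerciveSlotsOfNormG0 (coercive_slots_DeltaEta_of_normG₀ pos_slots_DeltaEta_of_normG₀)
open Summit.QuantumFields.YangMills.Theorems.Prop7SPrint (IsLandauPrint)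
open Summit.QuantumFields.YangMills.Theorems.Prop7QprimeCombL2 (QprimeCombL2 RcombL2 RcombL2_isSymmetric RcombL2_idem RcombL2_DstarL2_eq_zero_of_isLandauPrint_of_regPr)

variable (F : T3Family) {n K : ℕ} (hnK : n ≤ K) (c₀ cB a : ℝ) [Fact (0 < c₀)] [Fact (0 < cB)]

/-- ★★★ **(COERC) AT THE COMB SLOTS OF RECORD FROM `norm_G₀ᶜ` ALONE, IN THE DOOR'S `laplaceAK` LETTER**: on `RegPr F n K ε₀ W`, a right inverse `G₀` of
`laplaceAK (Δ^η W) (D_W) (RcombL2 W) (D*_W) (Qkc W) (Qkc W)† a` with `‖G₀ f‖ ≤ B₀‖f‖`, `1029·ε₀·B₀ < 1`, `a ≥ 0` ⟹ `B₀⁻¹·‖y‖² ≤ re⟪y, Δ_a y⟫` for all `y` (w4 g8's generic ✓`coercive_slots_DeltaEta_of_normG₀` at `Rr := RcombL2 W`,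
symmetric idempotent by ✓`RcombL2_isSymmetric`∕✓`RcombL2_idem`). [cite: Balaban1985BackgroundPropagators, Thm 3.11 p.416, Thm 3.3 p.399, (3.26) p.395, (3.21) p.394, (3.10) p.392] -/
theorem coercive_laplaceAK_RcombL2_of_normG₀ {ε₀ : ℝ} (hε₀ : 0 ≤ ε₀) (W : GaugeField (F.P K) 0 (Matrix.specialUnitaryGroup (Fin 2) ℂ)) (hreg : RegPr F n K ε₀ W)
    (ha : 0 ≤ a) {B₀ : ℝ} (hB₀ : 0 < B₀) (hwin : 1029 * ε₀ * B₀ < 1)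
    (G₀ : BondL2K ℂ 3 (periodsT3 F K) c₀ W₂ →ₗ[ℂ] BondL2K ℂ 3 (periodsT3 F K) c₀ W₂)
    (hG : laplaceAK (DeltaEtaSlot F n K c₀ W) (DL2 F n K c₀ W) (RcombL2 F n K c₀ W) (DstarL2 F n K c₀ W) (Qkc F n K hnK c₀ cB W)
        (LinearMap.adjoint (Qkc F n K hnK c₀ cB W)) ((a : ℝ) : ℂ) ∘ₗ G₀ = LinearMap.id)
    (hGB : ∀ f, ‖G₀ f‖ ≤ B₀ * ‖f‖) (y : BondL2K ℂ 3 (periodsT3 F K) c₀ W₂) :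
    B₀⁻¹ * ‖y‖ ^ 2 ≤ RCLike.re ⟪y, laplaceAK (DeltaEtaSlot F n K c₀ W) (DL2 F n K c₀ W) (RcombL2 F n K c₀ W) (DstarL2 F n K c₀ W) (Qkc F n K hnK c₀ cB W)
        (LinearMap.adjoint (Qkc F n K hnK c₀ cB W)) ((a : ℝ) : ℂ) y⟫_ℂ :=
  -- the generic-slot theorem at `Rr := RcombL2 W` (symmetric idempotent by lit `projR_isSymmetric`∕`projR_projR`); w4's `_projR` corollary asks an inner-product
  -- structure on `Q′`'s codomain, which the print-literal `QprimeCombL2` (values in `Site (F.P K) (K − n) → M₂(ℂ)`) does not carry and does not need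
  coercive_slots_DeltaEta_of_normG₀ F n K c₀ hε₀ W hreg (RcombL2 F n K c₀ W) (RcombL2_isSymmetric W) (RcombL2_idem W) (Qkc F n K hnK c₀ cB W) ha hB₀ hwin
    G₀ hG hGB y

/-- ★★★ **THE SAME IN px6 g5's `laplaceAcR` LETTER** (`laplaceAcR … (DeltaEtaSlot) W (RcombL2 W) = laplaceAK …` by ✓`laplaceAcR_eq_laplaceAK`, `rfl`): the comb (A′) lane's (COERC) row with `γ := B₀⁻¹`
from the displayed N06 row `norm_G₀ᶜ` at the slot of record. [cite: Balaban1985BackgroundPropagators, Thm 3.11 p.416, Thm 3.3 p.399, (3.26) p.395] -/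
theorem coercive_laplaceAcR_RcombL2_of_normG₀ {ε₀ : ℝ} (hε₀ : 0 ≤ ε₀) (W : GaugeField (F.P K) 0 (Matrix.specialUnitaryGroup (Fin 2) ℂ)) (hreg : RegPr F n K ε₀ W)
    (ha : 0 ≤ a) {B₀ : ℝ} (hB₀ : 0 < B₀) (hwin : 1029 * ε₀ * B₀ < 1)
    (G₀ : BondL2K ℂ 3 (periodsT3 F K) c₀ W₂ →ₗ[ℂ] BondL2K ℂ 3 (periodsT3 F K) c₀ W₂)
    (hG : laplaceAcR F n K hnK c₀ cB a (DeltaEtaSlot F n K c₀) W (RcombL2 F n K c₀ W) ∘ₗ G₀ = LinearMap.id)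
    (hGB : ∀ f, ‖G₀ f‖ ≤ B₀ * ‖f‖) (y : BondL2K ℂ 3 (periodsT3 F K) c₀ W₂) :
    B₀⁻¹ * ‖y‖ ^ 2 ≤ RCLike.re ⟪y, laplaceAcR F n K hnK c₀ cB a (DeltaEtaSlot F n K c₀) W (RcombL2 F n K c₀ W) y⟫_ℂ := by
  rw [laplaceAcR_eq_laplaceAK] at hG ⊢
  exact coercive_laplaceAK_RcombL2_of_normG₀ F hnK c₀ cB a hε₀ W hreg ha hB₀ hwin G₀ hG hGB y

/-- ★ **The EX display's `hPosΔ` shape at the comb slots of record**: `x ≠ 0 → 0 < re⟪x, Δ_aᶜ(W) x⟫`, from the same rows (`RcombL2` symmetric idempotent).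
[cite: Balaban1985BackgroundPropagators, Thm 3.11 p.416] -/
theorem pos_laplaceAcR_RcombL2_of_normG₀ {ε₀ : ℝ} (hε₀ : 0 ≤ ε₀) (W : GaugeField (F.P K) 0 (Matrix.specialUnitaryGroup (Fin 2) ℂ)) (hreg : RegPr F n K ε₀ W)
    (ha : 0 ≤ a) {B₀ : ℝ} (hB₀ : 0 < B₀) (hwin : 1029 * ε₀ * B₀ < 1)
    (G₀ : BondL2K ℂ 3 (periodsT3 F K) c₀ W₂ →ₗ[ℂ] BondL2K ℂ 3 (periodsT3 F K) c₀ W₂)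
    (hG : laplaceAcR F n K hnK c₀ cB a (DeltaEtaSlot F n K c₀) W (RcombL2 F n K c₀ W) ∘ₗ G₀ = LinearMap.id)
    (hGB : ∀ f, ‖G₀ f‖ ≤ B₀ * ‖f‖) (x : BondL2K ℂ 3 (periodsT3 F K) c₀ W₂) (hx : x ≠ 0) :
    0 < RCLike.re ⟪x, laplaceAcR F n K hnK c₀ cB a (DeltaEtaSlot F n K c₀) W (RcombL2 F n K c₀ W) x⟫_ℂ := by
  rw [laplaceAcR_eq_laplaceAK] at hG ⊢
  exact pos_slots_DeltaEta_of_normG₀ F n K c₀ hε₀ W hreg (RcombL2 F n K c₀ W) (RcombL2_isSymmetric W) (RcombL2_idem W) (Qkc F n K hnK c₀ cB W) ha hB₀ hwin G₀ hG hGB x hx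

/-- ★★★ **(COERC) ∧ (LANDAU-S) AT THE COMB SLOTS OF RECORD** — the two conjuncts the E2E hands to ✓`hcoS_of_sigmaRowsS` at `(Rr, Qc) := (RcombL2, Qkc)`, from: the displayed N06 datum `norm_G₀ᶜ`
(`G₀`, `hG`, `hGB`), `RegPr F n K ε₀ W` with `1029·ε₀·B₀ < 1` and the L-only unitarity windows `C₀(3)·2ε₀ ≤ ⅓`, `4ε₀ ≤ c₂′(3, L)` ([B-Avg] Prop. 2), and the representative's
`IsLandauPrint F n K W X` (✓p687911).  Conclusion: `(∀ y, B₀⁻¹‖y‖² ≤ re⟪y, Δ_a y⟫) ∧ RcombL2 W (DstarL2 W (toL2 X)) = 0`, both in the door's literal `laplaceAK`∕`DstarL2` letters.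
[cite: Balaban1985BackgroundPropagators, Thm 3.11 p.416, (3.21) p.394, (3.26) p.395; Balaban1985Variational, (21) p.281, (141)-(142) p.299; Balaban1985RegularSpaces, (1.38) p.82] -/
theorem coerc_landau_RcombL2_of_normG₀_of_isLandauPrint {ε₀ : ℝ} (hε₀ : 0 < ε₀) (hα3 : C0 (F.P K).d * (2 * ε₀) ≤ 1 / 3) (hα4 : 4 * ε₀ ≤ c2' (F.P K).d (F.P K).L)
    (W : GaugeField (F.P K) 0 (Matrix.specialUnitaryGroup (Fin 2) ℂ)) (hreg : RegPr F n K ε₀ W)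
    (ha : 0 ≤ a) {B₀ : ℝ} (hB₀ : 0 < B₀) (hwin : 1029 * ε₀ * B₀ < 1)
    (G₀ : BondL2K ℂ 3 (periodsT3 F K) c₀ W₂ →ₗ[ℂ] BondL2K ℂ 3 (periodsT3 F K) c₀ W₂)
    (hG : laplaceAK (DeltaEtaSlot F n K c₀ W) (DL2 F n K c₀ W) (RcombL2 F n K c₀ W) (DstarL2 F n K c₀ W) (Qkc F n K hnK c₀ cB W)
        (LinearMap.adjoint (Qkc F n K hnK c₀ cB W)) ((a : ℝ) : ℂ) ∘ₗ G₀ = LinearMap.id)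
    (hGB : ∀ f, ‖G₀ f‖ ≤ B₀ * ‖f‖)
    {X : PBond (F.P K) 0 → Matrix (Fin 2) (Fin 2) ℂ} (hLan : IsLandauPrint F n K W X) :
    (∀ y : BondL2K ℂ 3 (periodsT3 F K) c₀ W₂,
        B₀⁻¹ * ‖y‖ ^ 2 ≤ RCLike.re ⟪y, laplaceAK (DeltaEtaSlot F n K c₀ W) (DL2 F n K c₀ W) (RcombL2 F n K c₀ W) (DstarL2 F n K c₀ W) (Qkc F n K hnK c₀ cB W)
          (LinearMap.adjoint (Qkc F n K hnK c₀ cB W)) ((a : ℝ) : ℂ) y⟫_ℂ) ∧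
      RcombL2 F n K c₀ W (DstarL2 F n K c₀ W (toL2 F K c₀ X)) = 0 :=
  ⟨fun y => coercive_laplaceAK_RcombL2_of_normG₀ F hnK c₀ cB a hε₀.le W hreg ha hB₀ hwin G₀ hG hGB y,
    RcombL2_DstarL2_eq_zero_of_isLandauPrint_of_regPr hnK hε₀ hα3 hα4 hreg hLan⟩

end Summit.QuantumFields.YangMills.Theorems.Prop7CoerciveOfNormG0Comb

end
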